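import Summits.QuantumFields.YangMills.Theorems.FemtoCurvatureTwoPoint.Negative.AxisLowerFiniteGroup
import Literature.Probability.LatticeModels.MaxwellKernelBand

/-!
# `FemtoCurvatureTwoPoint`, line `generic-step-gamma-encoding`: the open stub GD⁻
# (`stub_axisGaussianLower`) is FALSE once `IsCompactSimpleLieGroup G` is weakened to `Nontrivial G`

Negative-side lemma for crux `Summit.QuantumFields.YangMills.Theses.LangevinControlUV.
FemtoCurvatureTwoPoint` (item stmt-QuantumFields-9363; cdisprove gen 2, attack on the picked line
`Cruxes/FemtoCurvatureTwoPoint/Lines/generic_step_gamma_encoding.lean`, lead c1).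

The line's hardest open stub GD⁻ (`stub_axisGaussianLower`, "Gaussian domination from below on the
axis") asks, for every compact simple Lie `G` and faithful unitary `r`, for ONE `κ > 0` and
per-torus thresholds `B(L)` with `κ · K_L(n e₂)² ≤ β² · Cov_{L,β}(P_0^{01}, P_{ne₂}^{01})` for
`β ≥ B(L)`, `1 ≤ n ≤ L/8`, where `K_L` is the tree-level plaquette kernel (second differences of
the torus Green function, Literature `MaxwellKernelBand`).

* `stub_axisGaussianLower_nontrivial_false` — the stub with `IsCompactSimpleLieGroup G` weakened to
  `Nontrivial G` (everything else verbatim, including the free Borel-structure binders) is FALSE: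
  witness `rootsOfUnityCircle 2 ≅ ℤ₂` with its defining character `znRep 2`, the torus `L = 8`,
  `n = 1`: the kernel side is `κ · K_8(e₂)² ≥ κ c² > 0` by the landed kernel band
  (`torusGreen_second_difference_axis_band`: `c ≤ n⁴ K`), while the covariance side is
  `β² Cov_β ≤ β² M e^{-8βδ} → 0` by the exponential freezing of the axis covariance for finite
  gauge groups (`Negative.AxisLowerFiniteGroup.eventually_axisCov_le`, drefute p83506).

So `ConnectedSpace G` is load-bearing for GD⁻ exactly as for the crux (`Negative.FiniteGroupFalse`)
and for the older stub `stub_axisLower` (`Negative.AxisLowerFiniteGroup`): any proof of GD⁻ must use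
that `G` is a Lie group of positive dimension (both sides `Θ(β⁻²)`), not merely compact.
-/

noncomputable section

open Filter Topology
open Literature.MathematicalPhysics.QuantumFieldTheory
open Literature.Barriers.QuantumFields
open Literature.Probability.LatticeModels (torusGreen torusGreen_second_difference_axis_band)
open Summit.QuantumFields.YangMills.Theorems.FemtoCurvatureTwoPoint.Negative.AxisLowerFiniteGroup
  (eventually_axisCov_le)

namespace Summit.QuantumFields.YangMills.Theorems.FemtoCurvatureTwoPoint.Negative.AxisGaussianLowerFiniteGroup

/-- **`ConnectedSpace G` is load-bearing for the stub GD⁻ (`stub_axisGaussianLower`).** The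
statement below is the registered stub of the line `generic-step-gamma-encoding` with
`IsCompactSimpleLieGroup G` weakened to `Nontrivial G`, everything else verbatim — and it is FALSE
(witness `ℤ₂`, `L = 8`, `n = 1`). -/
theorem stub_axisGaussianLower_nontrivial_false :
    ¬ (∀ (G : Type) [Group G] [TopologicalSpace G] [IsTopologicalGroup G] [CompactSpace G]
      [MeasurableSpace G] [BorelSpace G], Nontrivial G →
    ∀ (r : LatticeRep G), ∃ κ : ℝ, 0 < κ ∧ ∀ (L : ℕ) [NeZero L], ∃ B : ℝ, ∀ (β : ℝ), B ≤ β →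
      ∀ (n : ℕ), 1 ≤ n → 8 * n ≤ L →
        κ * (((2 * Literature.Probability.LatticeModels.torusGreen
                  (Pi.single (2 : Fin 4) ((n : ℕ) : ZMod L) : Fin 4 → ZMod L)
                - Literature.Probability.LatticeModels.torusGreen
                  ((Pi.single (2 : Fin 4) ((n : ℕ) : ZMod L) : Fin 4 → ZMod L)
                    + Pi.single (0 : Fin 4) (1 : ZMod L))
                - Literature.Probability.LatticeModels.torusGreen
                  ((Pi.single (2 : Fin 4) ((n : ℕ) : ZMod L) : Fin 4 → ZMod L)
                    - Pi.single (0 : Fin 4) (1 : ZMod L)))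
              + (2 * Literature.Probability.LatticeModels.torusGreen
                  (Pi.single (2 : Fin 4) ((n : ℕ) : ZMod L) : Fin 4 → ZMod L)
                - Literature.Probability.LatticeModels.torusGreen
                  ((Pi.single (2 : Fin 4) ((n : ℕ) : ZMod L) : Fin 4 → ZMod L)
                    + Pi.single (1 : Fin 4) (1 : ZMod L))
                - Literature.Probability.LatticeModels.torusGreen
                  ((Pi.single (2 : Fin 4) ((n : ℕ) : ZMod L) : Fin 4 → ZMod L)
                    - Pi.single (1 : Fin 4) (1 : ZMod L)))) / 2) ^ 2
          ≤ β ^ 2 *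
            (wilsonExpectation r.ρ β (fun U : GaugeConfig 4 L G =>
                ((r.N : ℝ) - (r.ρ (plaquetteHolonomy U 0 0 1)).trace.re) *
                  ((r.N : ℝ) - (r.ρ (plaquetteHolonomy U
                    (Pi.single (2 : Fin 4) ((n : ℕ) : ZMod L)) 0 1)).trace.re))
              - wilsonExpectation r.ρ β (fun U : GaugeConfig 4 L G =>
                  (r.N : ℝ) - (r.ρ (plaquetteHolonomy U 0 0 1)).trace.re)
                * wilsonExpectation r.ρ β (fun U : GaugeConfig 4 L G =>
                  (r.N : ℝ) - (r.ρ (plaquetteHolonomy U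
                    (Pi.single (2 : Fin 4) ((n : ℕ) : ZMod L)) 0 1)).trace.re))) := by
  intro h
  classical
  haveI : Fact (2 ≤ 2) := ⟨le_rfl⟩
  haveI : NeZero (8 : ℕ) := ⟨by norm_num⟩
  haveI : Fintype (rootsOfUnityCircle 2) := Fintype.ofFinite _
  letI : MeasurableSpace (rootsOfUnityCircle 2) := borel _
  haveI : BorelSpace (rootsOfUnityCircle 2) := ⟨rfl⟩
  let r : LatticeRep (rootsOfUnityCircle 2) :=
    ⟨1, znRep 2, continuous_znRep 2, znRep_injective 2, znRep_mem_unitaryGroup 2⟩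
  obtain ⟨κ, hκ, hL⟩ := h (rootsOfUnityCircle 2) inferInstance r
  obtain ⟨B, hB⟩ := hL 8
  -- the kernel `K = K_8(e₂)` and its positivity from the landed kernel band
  set K : ℝ := ((2 * torusGreen (Pi.single (2 : Fin 4) (((1 : ℕ) : ℕ) : ZMod 8) : Fin 4 → ZMod 8)
        - torusGreen ((Pi.single (2 : Fin 4) (((1 : ℕ) : ℕ) : ZMod 8) : Fin 4 → ZMod 8)
            + Pi.single (0 : Fin 4) (1 : ZMod 8))
        - torusGreen ((Pi.single (2 : Fin 4) (((1 : ℕ) : ℕ) : ZMod 8) : Fin 4 → ZMod 8)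
            - Pi.single (0 : Fin 4) (1 : ZMod 8)))
      + (2 * torusGreen (Pi.single (2 : Fin 4) (((1 : ℕ) : ℕ) : ZMod 8) : Fin 4 → ZMod 8)
        - torusGreen ((Pi.single (2 : Fin 4) (((1 : ℕ) : ℕ) : ZMod 8) : Fin 4 → ZMod 8)
            + Pi.single (1 : Fin 4) (1 : ZMod 8))
        - torusGreen ((Pi.single (2 : Fin 4) (((1 : ℕ) : ℕ) : ZMod 8) : Fin 4 → ZMod 8)
            - Pi.single (1 : Fin 4) (1 : ZMod 8)))) / 2 with hKdef
  obtain ⟨c, C, hc, hband⟩ := torusGreen_second_difference_axis_band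
  have h0 := (hband 8 0 2 (by decide) 1 le_rfl (by norm_num)).1
  have h1 := (hband 8 1 2 (by decide) 1 le_rfl (by norm_num)).1
  simp only [Nat.cast_one, one_pow, one_mul] at h0 h1
  have hcK : c ≤ K := by rw [hKdef]; linarith
  have hK2 : c ^ 2 ≤ K ^ 2 := pow_le_pow_left₀ hc.le hcK 2
  -- the stub at `L = 8`, `n = 1`, read against the frozen constant `K`
  have H8 : ∀ β : ℝ, B ≤ β → κ * K ^ 2 ≤ β ^ 2 *
      (wilsonExpectation (d := 4) (L := 8) (znRep 2) β (fun U =>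
          (((1 : ℕ) : ℝ) - ((znRep 2) (plaquetteHolonomy U (0 : Site 4 8) 0 1)).trace.re) *
            (((1 : ℕ) : ℝ) - ((znRep 2) (plaquetteHolonomy U
              (Pi.single (2 : Fin 4) (((1 : ℕ) : ℕ) : ZMod 8)) 0 1)).trace.re)) -
        wilsonExpectation (d := 4) (L := 8) (znRep 2) β (fun U =>
            ((1 : ℕ) : ℝ) - ((znRep 2) (plaquetteHolonomy U (0 : Site 4 8) 0 1)).trace.re) *
          wilsonExpectation (d := 4) (L := 8) (znRep 2) β (fun U => ((1 : ℕ) : ℝ) -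
            ((znRep 2) (plaquetteHolonomy U (Pi.single (2 : Fin 4) (((1 : ℕ) : ℕ) : ZMod 8))
              0 1)).trace.re)) := by
    intro β hβ
    have := hB β hβ 1 le_rfl (by norm_num)
    rw [hKdef]
    exact this
  clear_value K
  -- freezing: `Cov ≤ M ε⁸`, and `β² M ε⁸ → 0`
  obtain ⟨M, δ, hδ, hev⟩ := eventually_axisCov_le (G := rootsOfUnityCircle 2) (N := 1) (znRep 2)
    (znRep_mem_unitaryGroup 2) (znRep_injective 2)
  have hlim : Tendsto (fun β : ℝ => β ^ 2 * (M * Real.exp (-(β * δ)) ^ 8)) atTop (𝓝 0) := by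
    have hg : ∀ β : ℝ, β ^ 2 * (M * Real.exp (-(β * δ)) ^ 8) =
        (M / (8 * δ) ^ 2) * ((8 * δ * β) ^ 2 * Real.exp (-(8 * δ * β))) := by
      intro β
      have hδ' : δ ≠ 0 := hδ.ne'
      have e : Real.exp (-(β * δ)) ^ 8 = Real.exp (-(8 * δ * β)) := by
        rw [← Real.exp_nat_mul]; congr 1; push_cast; ring
      rw [e]
      field_simp
    simp_rw [hg]
    have h1 : Tendsto (fun x : ℝ => x ^ 2 * Real.exp (-x)) atTop (𝓝 0) :=
      Real.tendsto_pow_mul_exp_neg_atTop_nhds_zero 2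
    have h2 : Tendsto (fun β : ℝ => 8 * δ * β) atTop atTop :=
      tendsto_id.const_mul_atTop (by positivity)
    simpa [Function.comp_def] using (h1.comp h2).const_mul (M / (8 * δ) ^ 2)
  have hκc : 0 < κ * c ^ 2 := mul_pos hκ (pow_pos hc 2)
  have hevc : ∀ᶠ β : ℝ in atTop, β ^ 2 * (M * Real.exp (-(β * δ)) ^ 8) < κ * c ^ 2 :=
    hlim (Iio_mem_nhds hκc)
  obtain ⟨β, hβB, hβcov, hβc⟩ := ((eventually_ge_atTop B).and (hev.and hevc)).exists
  have hst := H8 β hβB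
  have h3 := mul_le_mul_of_nonneg_left hβcov (sq_nonneg β)
  have h4 : κ * c ^ 2 ≤ κ * K ^ 2 := mul_le_mul_of_nonneg_left hK2 hκ.le
  linarith

end Summit.QuantumFields.YangMills.Theorems.FemtoCurvatureTwoPoint.Negative.AxisGaussianLowerFiniteGroup

end
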